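import Summits.Ventures.FusionMHD.Bench.SolovevPCFIterMercierEdgeIntegrals2
import HarnessLib

/-!
# F1 / MERCIER at the ITER-like PCF edge — KERNEL BRIDGE 4/4: the GGJ input record of the TYPED equilibrium's edge
# surface equals the certificate's record; the Mercier criterion (Jardin (8.134)) on the tree's own functionals, end to end
(venture LADDER-GRIDFUSION, rung F1.MERCIER-profile; cell `gridfusion`, seat `gridfusion-sos-6` (g3), 2026-08-27; see
`…MercierEdgeSubst` for the purpose of the series.)

§4 the instance constants against the certificate's `√(|d₃|α)`: `κ₀·4√(|d₃|α) = c` (`κ₀² = E = α/|d₃|`, `c = 4α`),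
`√(q₀²/F²)·R_a³·8√(|d₃|α) = 1` (Freidberg (6.42): `(q₀/F)² = 1/(64α|d₃|u₀³)`), and `C_s = 1` (`Δ*Ψ = R²`).
§5 `lcEdgeData g := lcGGJData κ₀ g R_a q₀(g) (ε/R_a) g (ε/R_a)` field by field: `V′ = Vp`, `V″ = Vratio·Vp`, `Ψ′ = 2π`,
`Φ′ = gK₄/(4√(|d₃|α))`, `Φ″ = g·phihat·Vp`, `I′ = Vp/(2π)` (model-5's `lcGGJData_I'`, p485756), `p′ = −1`,
`⟨B²/G⟩ = B2G g`, `⟨σB²/G⟩ = gA6`, `⟨σ²B²/G⟩ = Xavg g`, `⟨1/B²⟩ = Yavg g`; **`lcEdgeData_eq_edgeData :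
lcEdgeData g = edgeData g (Vp/(2π))`** (all thirteen fields) and `mercierF_lcEdgeData`.
§6 **`mercierCriterion_lcEdgeData_of_le : ∀ g ≥ 3/5, (lcEdgeData g).MercierCriterion`** — Jardin (8.134) `F > 0` for the
record of `volumeDerivE/toroidalFluxDerivJ/toroidalCurrentJ/surfaceAverageE` of the typed `Ψ` (`IterLike.psi_eq_psiLC`;
`volumeDerivE_psi_edge` spells one field with `IterLike.psi` itself) — by `lcEdgeData_eq_edgeData` and p481977's
`mercierCriterion_edge_of_le`; label independence `((lcEdgeData g).relabel h₁ h₂).MercierCriterion` (`h₁ ≠ 0`) by model-5's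
force balance `lcGGJData_isForceBalanced` + lit-3's `mercierCriterion_relabel_iff`; `mercierAxis_and_lcEdge_of_le`: for
`F ≥ F_M⁺ = 0.61902799408906489485` near-axis Mercier (p472219) AND the edge criterion on the typed objects.
What is STILL not here: the loop is the printed Lee–Cerfon parametrisation `lcLoop` (that it traces `{Ψ = 0} ∩ {R > 0}`
once is model-5's `SolovevFluxSurfaceLoopTrace`); interior surfaces `0 < r < a` (certified only near the axis, p472219, and at
the edge); the VALIDATED threshold picture (axis binding, `g_M(edge) ≈ 0.367`) stays in cert/F/mercier-dm-validated.md.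
HONEST FRAMING (LADDER-GRIDFUSION three columns, never merged): CERTIFIED = kernel identities/inequalities about the MODEL's
edge surface (ideal MHD, axisymmetric, Solov'ev profiles `μ₀p′ = −1`, `FF′ = 0`, analytic fixed-boundary PCF equilibrium
[cite: PatakiCerfonFreidberg2013, §6.1], free constant `F = RB_φ` a parameter); VALIDATED cross-checks live in
`pub/gridfusion/cert/F/mercier-dm-validated.md`; Mercier/GGJ is a NECESSARY (local interchange) criterion; nothing here says
any plasma or device is stable. No `native_decide`; no `decide` in this file (the enclosures are the imported Data files').
-/

noncomputable section

open Real MeasureTheory Set intervalIntegral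
open Literature.Analysis.ValidatedNumerics Literature.Analysis.ValidatedNumerics.PolyMP
open Literature.Analysis.ValidatedNumerics.ExpPoly (Poly)
open Literature.MathematicalPhysics.MHD Literature.MathematicalPhysics.MHD.Solovev
open Summit.Ventures.FusionMHD.Models.SolovevPCF

namespace Summit.Ventures.FusionMHD.Bench.SolovevPCFIter.MercierEdge

/-! ## §4 The constants: `κ₀`, `q₀/F`, `C_s` of the instance against the certificate's `√(|d₃|α)` -/

/-- `κ₀·4√(|d₃|α) = c` (`κ₀² = E = α/|d₃|`, `c = 4α`). [folklore] -/
theorem kappa0_mul_sqrt : IterLike.kappa0 * (4 * Real.sqrt d3alpha) = (2257675225 / 6032287802 : ℝ) := by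
  have hk := IterLike.kappa0_pos
  have hs : 0 < Real.sqrt d3alpha := Real.sqrt_pos.2 (by unfold d3alpha; norm_num)
  have hsq : (IterLike.kappa0 * (4 * Real.sqrt d3alpha)) ^ 2 = (2257675225 / 6032287802 : ℝ) ^ 2 := by
    rw [mul_pow, mul_pow, IterLike.kappa0_sq, Real.sq_sqrt (by unfold d3alpha; norm_num)]
    unfold IterLike.elongSq d3alpha; norm_num
  exact (pow_left_inj₀ (by positivity) (by norm_num) two_ne_zero).1 hsq

/-- `κ₀ = c/(4√(|d₃|α))`. [folklore] -/
theorem kappa0_eq_div : IterLike.kappa0 = (2257675225 / 6032287802 : ℝ) / (4 * Real.sqrt d3alpha) := by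
  have hs : 0 < Real.sqrt d3alpha := Real.sqrt_pos.2 (by unfold d3alpha; norm_num)
  rw [eq_div_iff (by positivity), kappa0_mul_sqrt]

/-- `√(q₀²/F²)·R_a³·8√(|d₃|α) = 1` (`(q₀/F)² = 1/(64α|d₃|u₀³)`, `R_a² = u₀`). [folklore] -/
theorem sqrt_q0Sq_mul : Real.sqrt IterLike.q0SqOverFSq * IterLike.Ra ^ 3 * (8 * Real.sqrt d3alpha) = 1 := by
  have hs : 0 < Real.sqrt d3alpha := Real.sqrt_pos.2 (by unfold d3alpha; norm_num)
  have hq : 0 < Real.sqrt IterLike.q0SqOverFSq := Real.sqrt_pos.2 (by unfold IterLike.q0SqOverFSq; norm_num)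
  have hR := IterLike.Ra_pos
  have hsq : (Real.sqrt IterLike.q0SqOverFSq * IterLike.Ra ^ 3 * (8 * Real.sqrt d3alpha)) ^ 2 = 1 ^ 2 := by
    rw [mul_pow, mul_pow, mul_pow, Real.sq_sqrt (by unfold IterLike.q0SqOverFSq; norm_num),
      Real.sq_sqrt (by unfold d3alpha; norm_num), show (IterLike.Ra ^ 3) ^ 2 = (IterLike.Ra ^ 2) ^ 3 by ring,
      IterLike.Ra_sq]
    unfold IterLike.q0SqOverFSq d3alpha; norm_num
  exact (pow_left_inj₀ (by positivity) (by norm_num) two_ne_zero).1 hsq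

/-- `√(q₀²/F²) = 1/(8√(|d₃|α)R_a³)`. [folklore] -/
theorem sqrt_q0Sq_eq : Real.sqrt IterLike.q0SqOverFSq = 1 / (8 * Real.sqrt d3alpha * IterLike.Ra ^ 3) := by
  have hs : 0 < Real.sqrt d3alpha := Real.sqrt_pos.2 (by unfold d3alpha; norm_num)
  have hR := IterLike.Ra_pos
  rw [eq_div_iff (by positivity), ← sqrt_q0Sq_mul]
  ring

/-- **`C_s = 1` for the instance** (`Δ*Ψ = R²`: `μ₀p′ = −1`, `FF′ = 0`), from the Lee–Cerfon source constant
`C_s = F(κ₀ + 1/κ₀)/(R_a³q₀(F))`. [cite: PatakiCerfonFreidberg2013, §6.1] -/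
theorem csLC_edge {g : ℝ} (hg : 0 < g) : csLC IterLike.kappa0 g IterLike.Ra (IterLike.q0 g) = 1 := by
  have hk := IterLike.kappa0_pos
  have hs : 0 < Real.sqrt d3alpha := Real.sqrt_pos.2 (by unfold d3alpha; norm_num)
  have hR := IterLike.Ra_pos
  have hD : Real.sqrt d3alpha ^ 2 = d3alpha := Real.sq_sqrt (by unfold d3alpha; norm_num)
  unfold csLC
  rw [IterLike.q0_eq g hg.le, sqrt_q0Sq_eq, kappa0_eq_div]
  rw [div_eq_one_iff_eq (by positivity)]
  field_simp
  rw [hD]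
  unfold d3alpha
  ring

/-! ## §5 The data of the typed equilibrium's edge surface IS the certificate's edge data -/

/-- **model-5's GGJ input record of the EDGE surface of the ITER-like instance:** the thirteen Jardin (8.134) inputs
as the tree's functionals (`volumeDerivE`, `toroidalFluxDerivJ`, `toroidalCurrentJ`, `surfaceAverageE` of
`Literature/…/FluxSurfaceAverage`) of `Ψ = psiLC κ₀ g R_a q₀(g) (ε/R_a)` (`= IterLike.psi`, `IterLike.psi_eq_psiLC`) on the
printed loop `lcLoop R_a κ₀ (ε/R_a)` of the plasma edge `Ψ = 0`, with the free constant `F ≡ g`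
(`Solovev.lcGGJData`, p481986). [cite: Jardin2010, §8.5 eq. (8.134)] -/
def lcEdgeData (g : ℝ) : Literature.MathematicalPhysics.MHD.Mercier.FluxForm.SurfaceData :=
  lcGGJData IterLike.kappa0 g IterLike.Ra (IterLike.q0 g) (IterLike.ε / IterLike.Ra) g (IterLike.ε / IterLike.Ra)

section fields

variable {g : ℝ} (hg : 0 < g)
include hg

/-- `V′` of the typed edge surface `=` the certificate's `Vp = πK₁/(2√(|d₃|α))`. [cite: Jardin2010, §5.3 eq. (5.29)] -/
theorem lcEdgeData_V' : (lcEdgeData g).V' = Vp := by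
  unfold lcEdgeData Vp
  rw [lcGGJData_V' IterLike.Ra_pos IterLike.kappa0_pos hg (IterLike.q0_pos hg) IterLike.edge_minorRadius.1
    IterLike.edge_minorRadius.2, integral_w_edge hg, kappa0_eq_div]
  have hs : 0 < Real.sqrt d3alpha := Real.sqrt_pos.2 (by unfold d3alpha; norm_num)
  field_simp
  ring

/-- `V″` of the typed edge surface `=` `Vratio·Vp`. [cite: Jardin2010, §8.5 eq. (8.134)] -/
theorem lcEdgeData_V'' : (lcEdgeData g).V'' = Vratio * Vp := by
  unfold lcEdgeData Vp Vratio
  rw [lcGGJData_V'' IterLike.Ra_pos IterLike.kappa0_pos hg (IterLike.q0_pos hg) IterLike.edge_minorRadius.1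
    IterLike.edge_minorRadius.2, integral_wDr_edge hg, lcAmp_eq hg.ne', kappa0_eq_div]
  have hs : 0 < Real.sqrt d3alpha := Real.sqrt_pos.2 (by unfold d3alpha; norm_num)
  have hR := IterLike.Ra_pos
  have hK := K1_pos
  unfold ar IterLike.ε
  field_simp
  ring

omit hg in
/-- `Ψ′ = 2π`. [cite: Jardin2010, §5.3 eq. (5.32)] -/
theorem lcEdgeData_Ψ' : (lcEdgeData g).Ψ' = 2 * π := rfl

/-- `Φ′` of the typed edge surface `= g·K₄/(4√(|d₃|α))` (`= 2πq`). [cite: Jardin2010, §5.3 eq. (5.31)] -/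
theorem lcEdgeData_Φ' : (lcEdgeData g).Φ' = g * K4 / (4 * Real.sqrt d3alpha) := by
  unfold lcEdgeData
  rw [lcGGJData_Φ' IterLike.Ra_pos IterLike.kappa0_pos hg (IterLike.q0_pos hg) IterLike.edge_minorRadius.1
    IterLike.edge_minorRadius.2, integral_qKernel_edge, IterLike.q0_eq g hg.le, sqrt_q0Sq_eq]
  have hs : 0 < Real.sqrt d3alpha := Real.sqrt_pos.2 (by unfold d3alpha; norm_num)
  have hR := IterLike.Ra_pos
  have hπ := Real.pi_pos
  field_simp
  ring

/-- `Φ″` of the typed edge surface `= g·phihat·Vp`. [cite: Jardin2010, §8.5 eq. (8.134)] -/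
theorem lcEdgeData_Φ'' : (lcEdgeData g).Φ'' = g * phihat * Vp := by
  unfold lcEdgeData phihat Vp
  rw [lcGGJData_Φ'' IterLike.Ra_pos IterLike.kappa0_pos hg (IterLike.q0_pos hg) IterLike.edge_minorRadius.1
    IterLike.edge_minorRadius.2, integral_qKernelDr_edge, lcAmp_eq hg.ne', IterLike.q0_eq g hg.le, sqrt_q0Sq_eq]
  have hs : 0 < Real.sqrt d3alpha := Real.sqrt_pos.2 (by unfold d3alpha; norm_num)
  have hR := IterLike.Ra_pos
  have hπ := Real.pi_pos
  have hK := K1_pos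
  unfold ar IterLike.ε
  field_simp
  ring

/-- `p′ = −1` (`C_s = 1`). [cite: PatakiCerfonFreidberg2013, §6.1] -/
theorem lcEdgeData_p' : (lcEdgeData g).p' = -1 := by
  show -csLC IterLike.kappa0 g IterLike.Ra (IterLike.q0 g) = -1
  rw [csLC_edge hg]

/-- `I′ = dI/dΨ = Vp/(2π)` (surface-averaged force balance, `C_s = 1`). [cite: Jardin2010, §5.3 eq. (5.34)] -/
theorem lcEdgeData_I' : (lcEdgeData g).I' = Vp / (2 * π) := by
  unfold lcEdgeData Vp
  rw [lcGGJData_I' IterLike.Ra_pos IterLike.kappa0_pos hg (IterLike.q0_pos hg) IterLike.edge_minorRadius.1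
    IterLike.edge_minorRadius.2, integral_w_edge hg, csLC_edge hg, kappa0_eq_div]
  have hs : 0 < Real.sqrt d3alpha := Real.sqrt_pos.2 (by unfold d3alpha; norm_num)
  have hπ := Real.pi_pos
  field_simp
  ring

/-- `⟨B²/|∇Ψ|²⟩` of the typed edge surface `= B2G g = g²A7 + A4`. [cite: Jardin2010, §8.5 eq. (8.134)] -/
theorem lcEdgeData_gB2 : (lcEdgeData g).gB2 = B2G g := by
  unfold lcEdgeData B2G A7 A4
  rw [lcGGJData_gB2 IterLike.Ra_pos IterLike.kappa0_pos hg (IterLike.q0_pos hg) IterLike.edge_minorRadius.1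
    IterLike.edge_minorRadius.2, integral_w_edge hg]
  have hsplit : ∀ t, (g ^ 2 + lcGradSq IterLike.kappa0 g IterLike.Ra (IterLike.q0 g) (IterLike.ε / IterLike.Ra) t)
        / (lcU IterLike.Ra (IterLike.ε / IterLike.Ra) t
            * lcGradSq IterLike.kappa0 g IterLike.Ra (IterLike.q0 g) (IterLike.ε / IterLike.Ra) t)
        * lcAvgWeight IterLike.kappa0 g IterLike.Ra (IterLike.q0 g) (IterLike.ε / IterLike.Ra) t
      = g ^ 2 * (lcAvgWeight IterLike.kappa0 g IterLike.Ra (IterLike.q0 g) (IterLike.ε / IterLike.Ra) t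
          / (lcU IterLike.Ra (IterLike.ε / IterLike.Ra) t
              * lcGradSq IterLike.kappa0 g IterLike.Ra (IterLike.q0 g) (IterLike.ε / IterLike.Ra) t))
        + lcAvgWeight IterLike.kappa0 g IterLike.Ra (IterLike.q0 g) (IterLike.ε / IterLike.Ra) t
          / lcU IterLike.Ra (IterLike.ε / IterLike.Ra) t := by
    intro t
    have hu := (lcU_edge_pos t).ne'
    have hG := (lcGradSq_edge_pos hg t).ne'
    field_simp
  simp_rw [hsplit]
  rw [intervalIntegral.integral_add (((continuous_w_div_uG_edge hg).const_mul _).intervalIntegrable _ _)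
    ((continuous_w_div_u_edge hg).intervalIntegrable _ _), intervalIntegral.integral_const_mul,
    integral_w_div_uG_edge hg, integral_w_div_u_edge hg]
  have hk := IterLike.kappa0_pos
  have hK := K1_pos
  have hc4 := c4_pos
  field_simp

/-- `⟨σB²/|∇Ψ|²⟩` of the typed edge surface `= g·A6`. [cite: Jardin2010, §8.5 eq. (8.134)] -/
theorem lcEdgeData_gσB2 : (lcEdgeData g).gσB2 = g * A6 := by
  unfold lcEdgeData A6
  rw [lcGGJData_gσB2 IterLike.Ra_pos IterLike.kappa0_pos hg (IterLike.q0_pos hg) IterLike.edge_minorRadius.1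
    IterLike.edge_minorRadius.2, integral_w_edge hg, integral_w_div_G_edge hg, csLC_edge hg]
  have hk := IterLike.kappa0_pos
  have hK := K1_pos
  have hc4 := c4_pos
  field_simp

/-- `⟨σ²B²/|∇Ψ|²⟩` of the typed edge surface `= Xavg g = KX(g)/K₁`. [cite: Jardin2010, §8.5 eq. (8.134)] -/
theorem lcEdgeData_gσ2B2 : (lcEdgeData g).gσ2B2 = Xavg g := by
  unfold lcEdgeData Xavg
  rw [lcGGJData_gσ2B2 IterLike.Ra_pos IterLike.kappa0_pos hg (IterLike.q0_pos hg) IterLike.edge_minorRadius.1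
    IterLike.edge_minorRadius.2, integral_w_edge hg, integral_invBsqGradSq_edge hg, csLC_edge hg]
  have hk := IterLike.kappa0_pos
  have hK := K1_pos
  field_simp

/-- `⟨1/B²⟩` of the typed edge surface `= Yavg g = KY(g)/K₁`. [cite: Jardin2010, §8.5 eq. (8.134)] -/
theorem lcEdgeData_invB2 : (lcEdgeData g).invB2 = Yavg g := by
  unfold lcEdgeData Yavg
  rw [lcGGJData_invB2 IterLike.Ra_pos IterLike.kappa0_pos hg (IterLike.q0_pos hg) IterLike.edge_minorRadius.1
    IterLike.edge_minorRadius.2, integral_w_edge hg, integral_invBsq_edge hg]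
  have hk := IterLike.kappa0_pos
  have hK := K1_pos
  field_simp

/-- **THE KERNEL BRIDGE (record level):** the GGJ input record of the typed equilibrium's edge surface — every field a
functional of `Literature/…/FluxSurfaceAverage` evaluated on `Ψ` and the printed loop — EQUALS the certificate's
`edgeData g (Vp/(2π))` of `…MercierEdgeFluxForm` (p481977), all thirteen fields. [cite: Jardin2010, §8.5 eq. (8.134)] -/
theorem lcEdgeData_eq_edgeData : lcEdgeData g = edgeData g (Vp / (2 * π)) := by
  have h1 := lcEdgeData_V' hg
  have h2 := lcEdgeData_V'' hg
  have h5 := lcEdgeData_Φ' hg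
  have h6 := lcEdgeData_Φ'' hg
  have h7 := lcEdgeData_I' hg
  have h9 := lcEdgeData_p' hg
  have h10 := lcEdgeData_gB2 hg
  have h11 := lcEdgeData_gσB2 hg
  have h12 := lcEdgeData_gσ2B2 hg
  have h13 := lcEdgeData_invB2 hg
  unfold lcEdgeData lcGGJData at *
  unfold edgeData
  simp only [Literature.MathematicalPhysics.MHD.Mercier.FluxForm.SurfaceData.mk.injEq]
  refine ⟨h1, h2, ?_, ?_, h5, h6, h7, ?_, h9, h10, h11, h12, h13⟩ <;> trivial

/-- Jardin's `F` (8.134) of the typed edge surface `=` the certificate's `mercierF g`. [cite: Jardin2010, §8.5 eq. (8.134)] -/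
theorem mercierF_lcEdgeData : (lcEdgeData g).mercierF = mercierF g := by
  rw [lcEdgeData_eq_edgeData hg, mercierF_edgeData]

end fields

/-! ## §6 The certified Mercier statement on the typed equilibrium, end to end -/

/-- **F1 / MERCIER-profile at the EDGE, END TO END IN THE KERNEL (ITER-like PCF Solov'ev, F-parametric):** for every value
`g = F = RB_φ ≥ 3/5` of the free constant, the flux-coordinate Mercier criterion — Jardin (8.134) `F > 0` as typed by
`Mercier.FluxForm.SurfaceData.MercierCriterion` — holds for the record of the tree's OWN functionals (`volumeDerivE`,
`toroidalFluxDerivJ`, `toroidalCurrentJ`, `surfaceAverageE`) of the typed equilibrium `Ψ = psiLC κ₀ g R_a q₀(g) (ε/R_a)`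
(`= IterLike.psi`) on the printed edge loop. Chain: `lcGGJData` field lemmas (model-5, p481986) → §1 substitution →
kernel enclosures `K₁…K₈`, `KX ≤ K₈/(4αρ²)`, `KY ≤ K₅/g²` (p478089/p478835/p479207) → `mercierF_pos_of_le` (p479387).
MODELLED: ideal MHD, analytic fixed-boundary Solov'ev equilibrium; Mercier is NECESSARY for interchange stability; nothing
here says a plasma or device is stable. [cite: Jardin2010, §8.5 eq. (8.134)] -/
theorem mercierCriterion_lcEdgeData_of_le {g : ℝ} (hg : (3 / 5 : ℝ) ≤ g) : (lcEdgeData g).MercierCriterion := by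
  have hg0 : 0 < g := lt_of_lt_of_le (by norm_num) hg
  rw [lcEdgeData_eq_edgeData hg0]
  exact mercierCriterion_edge_of_le hg _

/-- The same record written with the typed flux function `IterLike.psi` itself (`psi_eq_psiLC`): e.g. its `V′` is
`volumeDerivE IterLike.psi (lcLoop R_a κ₀ (ε/R_a)) (2π) = Vp`. [cite: Freidberg2014, §6.3.2 eq. (6.22)] -/
theorem volumeDerivE_psi_edge {g : ℝ} (hg : 0 < g) :
    GradShafranov.volumeDerivE IterLike.psi (lcLoop IterLike.Ra IterLike.kappa0 (IterLike.ε / IterLike.Ra)) (2 * π)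
      = Vp := by
  rw [IterLike.psi_eq_psiLC hg.ne']
  exact lcEdgeData_V' hg

/-- **Label independence in the kernel:** the criterion holds for EVERY admissible relabelling `ψ ↦ h(ψ)` (`h′ ≠ 0`) of
the edge record (force balance `p′V′ + I′Ψ′ − K′Φ′ = 0` on the family is model-5's `lcGGJData_isForceBalanced`, p485756;
covariance is lit-3's `mercierCriterion_relabel_iff`, p479625). [cite: Jardin2010, §8.5 eq. (8.134)] -/
theorem mercierCriterion_lcEdgeData_relabel_of_le {g : ℝ} (hg : (3 / 5 : ℝ) ≤ g) (h1 h2 : ℝ) (hh : h1 ≠ 0) :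
    ((lcEdgeData g).relabel h1 h2).MercierCriterion := by
  have hg0 : 0 < g := lt_of_lt_of_le (by norm_num) hg
  exact (mercierCriterion_lcGGJData_relabel_iff IterLike.Ra_pos IterLike.kappa0_pos hg0 (IterLike.q0_pos hg0)
    IterLike.edge_minorRadius.1 IterLike.edge_minorRadius.2 _ g h1 h2 hh).2 (mercierCriterion_lcEdgeData_of_le hg)

/-- **Axis AND edge on the typed objects, one threshold:** for every `F ≥ F_M⁺ = 0.61902799408906489485` both the
near-axis Mercier criterion (Bateman (7.3.2); `…MercierAxis`, p472219) and the flux-coordinate Mercier criterion of the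
typed edge surface hold. [cite: Jardin2010, §8.5 eq. (8.134)] -/
theorem mercierAxis_and_lcEdge_of_le {F : ℝ} (hF : MercierAxis.FmercHi ≤ F) :
    Literature.MathematicalPhysics.MHD.Mercier.NearAxis.MercierCriterion (MercierAxis.q0 F) MercierAxis.elong 0 0
      ∧ (lcEdgeData F).MercierCriterion := by
  have h35 : (3 / 5 : ℝ) ≤ F := le_trans (by unfold MercierAxis.FmercHi; norm_num) hF
  exact ⟨MercierAxis.mercier_elong_of_le hF, mercierCriterion_lcEdgeData_of_le h35⟩

end Summit.Ventures.FusionMHD.Bench.SolovevPCFIter.MercierEdge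

end
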